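import Summits.AtomisticToContinuum.Crystallization.Theorems.FrustratedLawDichotomyStrainedPatchDirect
import Summits.AtomisticToContinuum.Crystallization.Theorems.FrustratedLawDichotomyStrainedPatchTaylorKbandMinus

/-!
# ★ (T2ᴰ⁻) PROVED and the DIRECT record (D) in the one-sided currency `w⁻` (lens-5 g56; crux 27623 T-side [CORE-FAR])

(Imports lens-5 g55 `…StrainedPatchDirect` (route (D): binders at the law, `ChartFamilyD = bentFamily 𝓑₀ (1/16)`, record `coreOff_record_g55d`) and g56
`…TaylorKbandMinus` ((T2⁻) on `𝓘₁ʷ`).)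

§1 ★★ `taylorTwoDMinus_holds : SmoothTaylorTwo ChartFamilyD tau0 delta0 G0 wMinus rho0` — (T2⁻) descends from `𝓘₁ʷ` (coarse `7/20`) to the chart family of
route (D) (coarse `1/4`) by family antitonicity and coarse-parameter monotonicity, exactly as g55's `taylorTwoD_of_W`; sanity (T2ᴰ⁻) ⟹ (T2ᴰ).
§2 the (LINᴰ) binder in the `w⁻` currency `SlavedDMinus Ψ := SlavedLaw ChartFamilyD tau0 delta0 T0 G0 wMinus Ψ` (WEAKER than `SlavedD Ψ`: `slavedDMinus_of_slavedD`),
and ★★★★ THE g56 DIRECT RECORD `coreOff_record_g56m` — [CORE-FAR] `CoreOffTubeFloor (63/10) (63/10) (24/5) (1/100) 0` from SEVEN hypotheses (BASᴰ) · (MEMᴰ μ) ·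
(LINᴰ⁻ Ψ) · (F2-bent₀) · (F3ᴰ (Ψ+ϱ₀+μ)) · [BRIDGE] · [SOFT-FAR], (T2ᴰ⁻) being the theorem of §1; `_cleared` (cleared membership column) and the EDGE band;
the g55 record is a COROLLARY (`coreOff_record_g55d_of_g56m`); the generic-currency form `coreOff_record_g55d_gw` (any `w, ϱ` with their own (T2)/(LIN)).
Pre-registered designation rule (writer NOTE v9.94, frozen): census A1 `M_D(T2⁻) ≥ +10 %` at every host ⇒ record := `coreOff_record_g56m`; else the W record
`coreOff_record_g56W` of `…TaylorKbandMinus` if BUDGET-ADM(g54W, T2⁻) `≥ +10 %`; (T2⁻)/(T2ᴰ⁻) are theorems either way.  Census BUDGET29 + critic row 1042: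
BOTH branches fail at HM62 / HE60 ⇒ HOST-CLASS SPLIT at `η* ∈ (0.0578, 0.0597)`, passing class := route (D) RETYPED with a FIXED basin radius `δ₀` —
§3 the host-class split seam (`familyEnvelopeLaw_of_split`; classes `ClassP ηP` / `ClassQ ηP` of `𝓘₀` by centre level; record `coreOff_record_g56_split`);
§4 the fixed-radius retype ((BAS-fix) `BasinFix`, (MEM-fix) `MembershipFix`, seam `familyEnvelopeLaw_of_taylor_fix` with NO law cap; records `coreOff_record_g56f`
(whole family) and ★★★★ THE DESIGNATE `coreOff_record_g56_splitFix ηP` (class P by (BASᴾ-fix) · (MEMᴾ-fix μ) · (LINᴾ⁻ Ψ), class Q one OPEN (F1-law) binder)).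
0 sorry.
-/

namespace Summit.AtomisticToContinuum.Crystallization.Theorems.FrustratedLawDichotomyStrainedPatchTaylorKbandMinusD

open scoped BigOperators Classical
open Summit.AtomisticToContinuum.Crystallization.Theorems.FrustratedLawDichotomyPeriodicBlockFlags (goodAtScale_mono)
open Summit.AtomisticToContinuum.Crystallization.Theorems.FrustratedLawDichotomyRangeCut (Sep)
open Summit.AtomisticToContinuum.Crystallization.Theorems.FrustratedLawDichotomyMotifLemmas
open Summit.AtomisticToContinuum.Crystallization.Theorems.FrustratedLawDichotomyAveragingCut
open Summit.AtomisticToContinuum.Crystallization.Theorems.FrustratedLawDichotomyAveragingRuleCap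
open Summit.AtomisticToContinuum.Crystallization.Theorems.FrustratedLawDichotomyAveragingRuleTightFree
open Summit.AtomisticToContinuum.Crystallization.Theorems.FrustratedLawDichotomyStrainedPatchHomSplit
open Summit.AtomisticToContinuum.Crystallization.Theorems.FrustratedLawDichotomyStrainedPatchCleanCollar
open Summit.AtomisticToContinuum.Crystallization.Theorems.FrustratedLawDichotomyStrainedPatchHomIsometry
open Summit.AtomisticToContinuum.Crystallization.Theorems.FrustratedLawDichotomyStrainedPatchHomTubeIso
open Summit.AtomisticToContinuum.Crystallization.Theorems.FrustratedLawDichotomyStrainedPatchPhaseCut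
open Summit.AtomisticToContinuum.Crystallization.Theorems.FrustratedLawDichotomyStrainedPatchCoreTube
open Summit.AtomisticToContinuum.Crystallization.Theorems.FrustratedLawDichotomyStrainedPatchCoreTubeRecord
open Summit.AtomisticToContinuum.Crystallization.Theorems.FrustratedLawDichotomyStrainedPatchStrainBands
open Summit.AtomisticToContinuum.Crystallization.Theorems.FrustratedLawDichotomyStrainedPatchChartFamilies
open Summit.AtomisticToContinuum.Crystallization.Theorems.FrustratedLawDichotomyStrainedPatchChartFamiliesBent
open Summit.AtomisticToContinuum.Crystallization.Theorems.FrustratedLawDichotomyStrainedPatchChartFamiliesPinned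
open Summit.AtomisticToContinuum.Crystallization.Theorems.FrustratedLawDichotomyStrainedPatchEnvelopeLaw
open Summit.AtomisticToContinuum.Crystallization.Theorems.FrustratedLawDichotomyStrainedPatchEnvelopeTaylor
open Summit.AtomisticToContinuum.Crystallization.Theorems.FrustratedLawDichotomyStrainedPatchWindowFamilies
open Summit.AtomisticToContinuum.Crystallization.Theorems.FrustratedLawDichotomyStrainedPatchRecutPairs
open Summit.AtomisticToContinuum.Crystallization.Theorems.FrustratedLawDichotomyStrainedPatchWindowTaylorTail (taylorTwoBentW_holds)
open Summit.AtomisticToContinuum.Crystallization.Theorems.FrustratedLawDichotomyStrainedPatchMembership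
open Summit.AtomisticToContinuum.Crystallization.Theorems.FrustratedLawDichotomyStrainedPatchDirect
open Summit.AtomisticToContinuum.Crystallization.Theorems.FrustratedLawDichotomyStrainedPatchTaylorPairSigned
open Summit.AtomisticToContinuum.Crystallization.Theorems.FrustratedLawDichotomyStrainedPatchTaylorKbandMinus

/-! ## §1. (T2ᴰ⁻) -/

/-- ★ **(T2ᴰ⁻)** `:= SmoothTaylorTwo 𝓘₀ (1/4) δ₀ G₀ w⁻ ϱ₀` — the second-order remainder lemma on the chart family of route (D) with the one-sided table. -/
def TaylorTwoDMinus : Prop := SmoothTaylorTwo ChartFamilyD tau0 delta0 G0 wMinus rho0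

/-- (T2⁻ on `𝓘₁ʷ`) ⟹ (T2ᴰ⁻) (family antitonicity + coarse-parameter monotonicity `1/4 ≤ 7/20`; g55 `taylorTwoD_of_W` verbatim). [formal bookkeeping] -/
theorem taylorTwoDMinus_of_W (h : TaylorTwoBentWMinus) : TaylorTwoDMinus :=
  smoothTaylorTwo_mono_tau (by rw [tau0, tau1]; norm_num) (smoothTaylorTwo_anti chartFamilyD_le_compFamilyW h)

/-- ★★ **(T2ᴰ⁻) HOLDS**: `SmoothTaylorTwo ChartFamilyD tau0 delta0 G0 wMinus rho0`. [folklore] -/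
theorem taylorTwoDMinus_holds : SmoothTaylorTwo ChartFamilyD tau0 delta0 G0 wMinus rho0 := taylorTwoDMinus_of_W taylorTwoBentWMinus_holds'

/-- Sanity edge (T2ᴰ⁻) ⟹ (T2ᴰ) (`w⁻ ≤ w₀`). [formal bookkeeping] -/
theorem taylorTwoD_of_minus (h : TaylorTwoDMinus) : TaylorTwoD := smoothTaylorTwo_mono_w wMinus_le_w0 h

/-! ## §2. (LINᴰ⁻) and the direct record in the `w⁻` currency -/

/-- (LIN-law) WEAKENS under DECREASE of the weight table (a smaller penalty charged against the linear response). [formal bookkeeping] -/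
theorem slavedLaw_mono_w {𝓘 : (M₀ : ℕ) → (Fin M₀ → E3) → Fin M₀ → Prop} {τ δ : ℝ} {T : (M₀ : ℕ) → (Fin M₀ → E3) → Fin M₀ → ℝ}
    {G : (M₁ : ℕ) → (Fin M₁ → E3) → Fin M₁ → Fin M₁ → (E3 →L[ℝ] ℝ)} {w w' : (M₁ : ℕ) → (Fin M₁ → E3) → Fin M₁ → Fin M₁ → Fin M₁ → ℝ}
    {Ψ : (M₁ : ℕ) → (Fin M₁ → E3) → Fin M₁ → ℝ → ℝ} (h : ∀ M₁ z₁ c₁ b b', w' M₁ z₁ c₁ b b' ≤ w M₁ z₁ c₁ b b') (hL : SlavedLaw 𝓘 τ δ T G w Ψ) :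
    SlavedLaw 𝓘 τ δ T G w' Ψ := by
  intro M z c M₀ z₀ c₀ e t hz hcl hm ht htT hch hf
  have h1 := hL M z c M₀ z₀ c₀ e t hz hcl hm ht htT hch hf
  have h2 := quadTerm_mono h z c z₀ c₀ e
  linarith

/-- ★ **(LINᴰ⁻ Ψ)** `:= SlavedLaw 𝓘₀ (1/4) δ₀ T₀ G₀ w⁻ Ψ` — the first-order LP on the raw deviation with the linear response charged against the ONE-SIDED penalty
`quad_{w⁻}` [MECHANICS · UNDECIDED · INSTRUMENTABLE: census A1 / JOINT LP in the `w⁻` currency]. -/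
def SlavedDMinus (Ψ : (M₁ : ℕ) → (Fin M₁ → E3) → Fin M₁ → ℝ → ℝ) : Prop := SlavedLaw ChartFamilyD tau0 delta0 T0 G0 wMinus Ψ

/-- (LINᴰ Ψ) ⟹ (LINᴰ⁻ Ψ): the same table certifies the weaker law. [formal bookkeeping] -/
theorem slavedDMinus_of_slavedD {Ψ : (M₁ : ℕ) → (Fin M₁ → E3) → Fin M₁ → ℝ → ℝ} (h : SlavedD Ψ) : SlavedDMinus Ψ := slavedLaw_mono_w wMinus_le_w0 h

/-- ★★ (BASᴰ) ∧ (MEMᴰ μ) ∧ (LINᴰ⁻ Ψ) ⟹ (F1ᴰ (Ψ + ϱ₀ + μ)), (T2ᴰ⁻) discharged. [folklore] -/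
theorem envelopeD_of_taylorMinus {Ψ : (M₁ : ℕ) → (Fin M₁ → E3) → Fin M₁ → ℝ → ℝ} {μ : (M₁ : ℕ) → (Fin M₁ → E3) → Fin M₁ → ℝ} (hB : BasinD) (hM : MembershipD μ)
    (hL : SlavedDMinus Ψ) : EnvelopeD (withColumns Ψ μ) :=
  familyEnvelopeLaw_of_taylor kA1_nonneg kA1_mul_tmax0_le lawLE_chartFamilyD hB taylorTwoDMinus_holds hM hL

/-- ★★★★ **THE g56 DIRECT RECORD `coreOff_record_g56m`** — [CORE-FAR] `CoreOffTubeFloor (63/10) (63/10) (24/5) (1/100) 0` from SEVEN hypotheses: (BASᴰ) · (MEMᴰ μ) ·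
(LINᴰ⁻ Ψ) · (F2-bent₀) = the tree's `FamilyRoomBent0` · (F3ᴰ (Ψ+ϱ₀+μ)) · [BRIDGE] · [SOFT-FAR]; (T2ᴰ⁻) is the theorem `taylorTwoDMinus_holds`. [folklore] -/
theorem coreOff_record_g56m {Ψ : (M₁ : ℕ) → (Fin M₁ → E3) → Fin M₁ → ℝ → ℝ} {μ : (M₁ : ℕ) → (Fin M₁ → E3) → Fin M₁ → ℝ} (hB : BasinD) (hM : MembershipD μ)
    (hL : SlavedDMinus Ψ) (hR : FamilyRoomBent0) (hC : FamilyCertD (withColumns Ψ μ))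
    (hBand : BandFarFloor (63 / 10) (63 / 10) (24 / 5) (1 / 100) (3 / 50) (1 / 10) 0) (hS : SoftFarFloor (63 / 10) (63 / 10) (24 / 5) (1 / 100) (1 / 10) 0) :
    CoreOffTubeFloor (63 / 10) (63 / 10) (24 / 5) (1 / 100) 0 :=
  coreOff_of_edge_of_band_of_soft (edgeFar_D (envelopeD_of_taylorMinus hB hM hL) hR hC) hBand hS

/-- ★★★ THE g56 DIRECT RECORD, EDGE BAND: the five binders ⟹ `EdgeFarFloor (63/10) (63/10) (24/5) (1/100) (3/50) 0`. [folklore] -/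
theorem edgeFar_record_g56m {Ψ : (M₁ : ℕ) → (Fin M₁ → E3) → Fin M₁ → ℝ → ℝ} {μ : (M₁ : ℕ) → (Fin M₁ → E3) → Fin M₁ → ℝ} (hB : BasinD) (hM : MembershipD μ)
    (hL : SlavedDMinus Ψ) (hR : FamilyRoomBent0) (hC : FamilyCertD (withColumns Ψ μ)) : EdgeFarFloor (63 / 10) (63 / 10) (24 / 5) (1 / 100) (3 / 50) 0 :=
  edgeFar_D (envelopeD_of_taylorMinus hB hM hL) hR hC

/-- ★★ THE g56 DIRECT RECORD WITH THE CLEARED COLUMN (g55 `membershipLaw_cleared`). [folklore] -/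
theorem coreOff_record_g56m_cleared {Ψ : (M₁ : ℕ) → (Fin M₁ → E3) → Fin M₁ → ℝ → ℝ} {μ : (M₁ : ℕ) → (Fin M₁ → E3) → Fin M₁ → ℝ} (hB : BasinD)
    (hM : MembershipD μ) (hL : SlavedDMinus Ψ) (hR : FamilyRoomBent0) (hC : FamilyCertD (withColumns Ψ (clearedColumn kA1 T0 μ)))
    (hBand : BandFarFloor (63 / 10) (63 / 10) (24 / 5) (1 / 100) (3 / 50) (1 / 10) 0) (hS : SoftFarFloor (63 / 10) (63 / 10) (24 / 5) (1 / 100) (1 / 10) 0) :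
    CoreOffTubeFloor (63 / 10) (63 / 10) (24 / 5) (1 / 100) 0 :=
  coreOff_record_g56m hB (membershipLaw_cleared (by rw [tau0]; norm_num) (fun _ _ _ hI => kA1_mul_T0_le hI) hM) hL hR hC hBand hS

/-- Sanity: the g55 record (LINᴰ in the `w₀` currency) is a COROLLARY of the g56 record. [formal bookkeeping] -/
theorem coreOff_record_g55d_of_g56m {Ψ : (M₁ : ℕ) → (Fin M₁ → E3) → Fin M₁ → ℝ → ℝ} {μ : (M₁ : ℕ) → (Fin M₁ → E3) → Fin M₁ → ℝ} (hB : BasinD) (hM : MembershipD μ)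
    (hL : SlavedD Ψ) (hR : FamilyRoomBent0) (hC : FamilyCertD (withColumns Ψ μ)) (hBand : BandFarFloor (63 / 10) (63 / 10) (24 / 5) (1 / 100) (3 / 50) (1 / 10) 0)
    (hS : SoftFarFloor (63 / 10) (63 / 10) (24 / 5) (1 / 100) (1 / 10) 0) : CoreOffTubeFloor (63 / 10) (63 / 10) (24 / 5) (1 / 100) 0 :=
  coreOff_record_g56m hB hM (slavedDMinus_of_slavedD hL) hR hC hBand hS

/-- The generic-currency form of the direct record: ANY weight table `w` and second-order column `ϱ` with their own (T2 on `𝓘₀`) and (LINᴰ) (for the census's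
choice of currency; g55 `coreOff_record_g55d_rho` is the case `w = w₀`). [formal bookkeeping] -/
theorem coreOff_record_g55d_gw {w : (M₁ : ℕ) → (Fin M₁ → E3) → Fin M₁ → Fin M₁ → Fin M₁ → ℝ} {Ψ : (M₁ : ℕ) → (Fin M₁ → E3) → Fin M₁ → ℝ → ℝ}
    {ϱ μ : (M₁ : ℕ) → (Fin M₁ → E3) → Fin M₁ → ℝ} (hB : BasinD) (hT2 : SmoothTaylorTwo ChartFamilyD tau0 delta0 G0 w ϱ) (hM : MembershipD μ)
    (hL : SlavedLaw ChartFamilyD tau0 delta0 T0 G0 w Ψ) (hR : FamilyRoomBent0) (hC : FamilyCertD fun M₁ z₁ c₁ t => Ψ M₁ z₁ c₁ t + ϱ M₁ z₁ c₁ + μ M₁ z₁ c₁)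
    (hBand : BandFarFloor (63 / 10) (63 / 10) (24 / 5) (1 / 100) (3 / 50) (1 / 10) 0) (hS : SoftFarFloor (63 / 10) (63 / 10) (24 / 5) (1 / 100) (1 / 10) 0) :
    CoreOffTubeFloor (63 / 10) (63 / 10) (24 / 5) (1 / 100) 0 :=
  coreOff_of_edge_of_band_of_soft (edgeFar_D (familyEnvelopeLaw_of_taylor kA1_nonneg kA1_mul_tmax0_le lawLE_chartFamilyD hB hT2 hM hL) hR hC) hBand hS

/-- Any (T2) on `𝓘₁ʷ` with table `w`, column `ϱ` descends to `𝓘₀` (for use with `coreOff_record_g55d_gw`). [formal bookkeeping] -/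
theorem smoothTaylorTwoD_of_W {w : (M₁ : ℕ) → (Fin M₁ → E3) → Fin M₁ → Fin M₁ → Fin M₁ → ℝ} {ϱ : (M₁ : ℕ) → (Fin M₁ → E3) → Fin M₁ → ℝ}
    (h : SmoothTaylorTwo CompFamilyW tau1 delta0 G0 w ϱ) : SmoothTaylorTwo ChartFamilyD tau0 delta0 G0 w ϱ :=
  smoothTaylorTwo_mono_tau (by rw [tau0, tau1]; norm_num) (smoothTaylorTwo_anti chartFamilyD_le_compFamilyW h)

/-! ## §3. The HOST-CLASS SPLIT seam (census BUDGET29 §1b / critic row 1042: `M_D(T2⁻)` = HM62 −12.9 % · HE60 +8.2 % · HE58 +16 % · HE55 +28 % ·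
HE52 +33/64 % · HZ00 +53/76 % · FZ00 +80 % ⇒ the frozen +10 % line splits the host family at a centre level `η* ∈ (0.0578, 0.0597)`) -/

/-- A family restricted to a host class `𝓟`. -/
def inClass (𝓘 𝓟 : (M₀ : ℕ) → (Fin M₀ → E3) → Fin M₀ → Prop) : (M₀ : ℕ) → (Fin M₀ → E3) → Fin M₀ → Prop := fun M₀ z₀ c₀ => 𝓘 M₀ z₀ c₀ ∧ 𝓟 M₀ z₀ c₀

/-- A family restricted to the complement of a host class `𝓟`. -/
def offClass (𝓘 𝓟 : (M₀ : ℕ) → (Fin M₀ → E3) → Fin M₀ → Prop) : (M₀ : ℕ) → (Fin M₀ → E3) → Fin M₀ → Prop := fun M₀ z₀ c₀ => 𝓘 M₀ z₀ c₀ ∧ ¬𝓟 M₀ z₀ c₀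

/-- `inClass 𝓘 𝓟 ≤ 𝓘`. [formal bookkeeping] -/
theorem inClass_le (𝓘 𝓟 : (M₀ : ℕ) → (Fin M₀ → E3) → Fin M₀ → Prop) : FamilyLE (inClass 𝓘 𝓟) 𝓘 := fun _ _ _ h => h.1

/-- `offClass 𝓘 𝓟 ≤ 𝓘`. [formal bookkeeping] -/
theorem offClass_le (𝓘 𝓟 : (M₀ : ℕ) → (Fin M₀ → E3) → Fin M₀ → Prop) : FamilyLE (offClass 𝓘 𝓟) 𝓘 := fun _ _ _ h => h.1

/-- ★ (F1-law) SPLITS over any host class: the law on `𝓘` follows from the law on `𝓘 ∩ 𝓟` and on `𝓘 ∖ 𝓟` (same modulus table). [formal bookkeeping] -/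
theorem familyEnvelopeLaw_of_split {𝓘 𝓟 : (M₀ : ℕ) → (Fin M₀ → E3) → Fin M₀ → Prop} {τ : ℝ} {T : (M₀ : ℕ) → (Fin M₀ → E3) → Fin M₀ → ℝ}
    {Φ : (M₀ : ℕ) → (Fin M₀ → E3) → Fin M₀ → ℝ → ℝ} (hP : FamilyEnvelopeLaw (inClass 𝓘 𝓟) τ T Φ) (hQ : FamilyEnvelopeLaw (offClass 𝓘 𝓟) τ T Φ) :
    FamilyEnvelopeLaw 𝓘 τ T Φ := by
  intro M z c M₀ z₀ c₀ e t hz hcl hm ht htT hch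
  by_cases hp : 𝓟 M₀ z₀ c₀
  · exact hP M z c M₀ z₀ c₀ e t hz hcl hm ht htT ⟨⟨hch.1, hp⟩, hch.2⟩
  · exact hQ M z c M₀ z₀ c₀ e t hz hcl hm ht htT ⟨⟨hch.1, hp⟩, hch.2⟩

/-- The host class of centre level `ηP`: the instance's centre is `ηP`-good at scale `3/2` (the census's host level `η`: HM62 0.0624, HE60 0.0597, HE58 0.0578, …). -/
def levelClass (ηP : ℝ) : (M₀ : ℕ) → (Fin M₀ → E3) → Fin M₀ → Prop := fun _ z₀ c₀ => GoodAtScale ηP (3 / 2) z₀ c₀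

/-- ★ **THE PASSING CLASS `𝓘₀ᴾ(ηP) := 𝓘₀ ∩ {ηP-good centre}`** (= `bentFamily 𝓑₀ ηP` as a set when `ηP ≤ 1/16`). -/
def ClassP (ηP : ℝ) : (M₀ : ℕ) → (Fin M₀ → E3) → Fin M₀ → Prop := inClass ChartFamilyD (levelClass ηP)

/-- ★ **THE ROUGH CLASS `𝓘₀ꟴ(ηP) := 𝓘₀ ∖ {ηP-good centre}`** (centre level in `(ηP, 1/16]`: HM62, HE60 at `ηP = 29/500`). -/
def ClassQ (ηP : ℝ) : (M₀ : ℕ) → (Fin M₀ → E3) → Fin M₀ → Prop := offClass ChartFamilyD (levelClass ηP)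

/-- `𝓘₀ᴾ ≤ 𝓘₀`. [formal bookkeeping] -/
theorem classP_le_D (ηP : ℝ) : FamilyLE (ClassP ηP) ChartFamilyD := inClass_le _ _

/-- `𝓘₀ꟴ ≤ 𝓘₀`. [formal bookkeeping] -/
theorem classQ_le_D (ηP : ℝ) : FamilyLE (ClassQ ηP) ChartFamilyD := offClass_le _ _

/-- `𝓘₀ᴾ(ηP) ≤ bentFamily 𝓑₀ ηP` and conversely for `ηP ≤ 1/16`. [formal bookkeeping] -/
theorem classP_le_bent (ηP : ℝ) : FamilyLE (ClassP ηP) (bentFamily bends0 ηP) := fun _ _ _ h => ⟨h.1.1, h.1.2.1, h.2⟩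

/-- Conversely `bentFamily 𝓑₀ ηP ≤ 𝓘₀ᴾ(ηP)` for `ηP ≤ η₀₀` (docstring added at landing, hand-2 g27: gate lint.docstring). [formal bookkeeping] -/
theorem bent_le_classP {ηP : ℝ} (hη : ηP ≤ eta00) : FamilyLE (bentFamily bends0 ηP) (ClassP ηP) :=
  fun _ _ _ h => ⟨⟨h.1, h.2.1, goodAtScale_mono hη h.2.2⟩, h.2.2⟩

/-- (LAW) on the passing class. [formal bookkeeping] -/
theorem lawLE_classP (ηP : ℝ) : LawLE (ClassP ηP) T0 tmax0 := fun M₀ z₀ c₀ h => lawLE_chartFamilyD M₀ z₀ c₀ h.1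

/-- (T2⁻) on the passing class is a THEOREM (antitonicity from (T2ᴰ⁻)). [formal bookkeeping] -/
theorem taylorTwoMinus_classP (ηP : ℝ) : SmoothTaylorTwo (ClassP ηP) tau0 delta0 G0 wMinus rho0 := smoothTaylorTwo_anti (classP_le_D ηP) taylorTwoDMinus_holds

/-- ★★ (F1-law on `𝓘₀ᴾ`) ⟸ (BASᴾ) ∧ (MEMᴾ μ) ∧ (LINᴾ⁻ Ψ) — the route-(D) level-2 seam ON THE PASSING CLASS, (T2⁻) discharged. [folklore] -/
theorem envelopeP_of_taylorMinus {ηP : ℝ} {Ψ : (M₁ : ℕ) → (Fin M₁ → E3) → Fin M₁ → ℝ → ℝ} {μ : (M₁ : ℕ) → (Fin M₁ → E3) → Fin M₁ → ℝ}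
    (hB : BasinLaw (ClassP ηP) tau0 kA1 T0) (hM : MembershipLaw (ClassP ηP) tau0 kA1 T0 μ) (hL : SlavedLaw (ClassP ηP) tau0 delta0 T0 G0 wMinus Ψ) :
    FamilyEnvelopeLaw (ClassP ηP) tau0 T0 (withColumns Ψ μ) :=
  familyEnvelopeLaw_of_taylor kA1_nonneg kA1_mul_tmax0_le (lawLE_classP ηP) hB (taylorTwoMinus_classP ηP) hM hL

/-- ★★★ **THE HOST-CLASS SPLIT RECORD `coreOff_record_g56_split ηP`** — [CORE-FAR] `CoreOffTubeFloor (63/10) (63/10) (24/5) (1/100) 0` from: the route-(D) pieces ON THE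
PASSING CLASS (BASᴾ) · (MEMᴾ μ) · (LINᴾ⁻ Ψ) [(T2⁻) a theorem there] · ONE binder (F1-law on the rough class `𝓘₀ꟴ(ηP)`) [UNDECIDED · IDEA-NEEDED: second-order force
rows in the polytope (SOCP) or a new far functional — BUDGET29 §4 item 3; nonlinearly the maximisers are admissible only at scale `≤ 0.47–0.62` with TRUE margin
`+41/+33 %`] · (F2-bent₀) · (F3ᴰ (Ψ+ϱ₀+μ)) · [BRIDGE] · [SOFT-FAR].  Record threshold `ηP = 29/500 ∈ (0.0578, 0.0597)`; any `ηP` is admitted. [folklore] -/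
theorem coreOff_record_g56_split (ηP : ℝ) {Ψ : (M₁ : ℕ) → (Fin M₁ → E3) → Fin M₁ → ℝ → ℝ} {μ : (M₁ : ℕ) → (Fin M₁ → E3) → Fin M₁ → ℝ}
    (hBP : BasinLaw (ClassP ηP) tau0 kA1 T0) (hMP : MembershipLaw (ClassP ηP) tau0 kA1 T0 μ) (hLP : SlavedLaw (ClassP ηP) tau0 delta0 T0 G0 wMinus Ψ)
    (hQ : FamilyEnvelopeLaw (ClassQ ηP) tau0 T0 (withColumns Ψ μ)) (hR : FamilyRoomBent0) (hC : FamilyCertD (withColumns Ψ μ))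
    (hBand : BandFarFloor (63 / 10) (63 / 10) (24 / 5) (1 / 100) (3 / 50) (1 / 10) 0) (hS : SoftFarFloor (63 / 10) (63 / 10) (24 / 5) (1 / 100) (1 / 10) 0) :
    CoreOffTubeFloor (63 / 10) (63 / 10) (24 / 5) (1 / 100) 0 :=
  coreOff_of_edge_of_band_of_soft (edgeFar_D (familyEnvelopeLaw_of_split (envelopeP_of_taylorMinus hBP hMP hLP) hQ) hR hC) hBand hS

/-- The EDGE band of the split record. [folklore] -/
theorem edgeFar_record_g56_split (ηP : ℝ) {Ψ : (M₁ : ℕ) → (Fin M₁ → E3) → Fin M₁ → ℝ → ℝ} {μ : (M₁ : ℕ) → (Fin M₁ → E3) → Fin M₁ → ℝ}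
    (hBP : BasinLaw (ClassP ηP) tau0 kA1 T0) (hMP : MembershipLaw (ClassP ηP) tau0 kA1 T0 μ) (hLP : SlavedLaw (ClassP ηP) tau0 delta0 T0 G0 wMinus Ψ)
    (hQ : FamilyEnvelopeLaw (ClassQ ηP) tau0 T0 (withColumns Ψ μ)) (hR : FamilyRoomBent0) (hC : FamilyCertD (withColumns Ψ μ)) :
    EdgeFarFloor (63 / 10) (63 / 10) (24 / 5) (1 / 100) (3 / 50) 0 :=
  edgeFar_D (familyEnvelopeLaw_of_split (envelopeP_of_taylorMinus hBP hMP hLP) hQ) hR hC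

/-- The passing-class binders are implied by the whole-family (D) binders (antitonicity) — the split record asks LESS of route (D). [formal bookkeeping] -/
theorem classP_binders_of_D (ηP : ℝ) {Ψ : (M₁ : ℕ) → (Fin M₁ → E3) → Fin M₁ → ℝ → ℝ} {μ : (M₁ : ℕ) → (Fin M₁ → E3) → Fin M₁ → ℝ} (hB : BasinD) (hM : MembershipD μ)
    (hL : SlavedDMinus Ψ) : BasinLaw (ClassP ηP) tau0 kA1 T0 ∧ MembershipLaw (ClassP ηP) tau0 kA1 T0 μ ∧ SlavedLaw (ClassP ηP) tau0 delta0 T0 G0 wMinus Ψ :=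
  ⟨basinLaw_anti (classP_le_D ηP) le_rfl hB, membershipLaw_anti (classP_le_D ηP) hM, slavedLaw_anti (classP_le_D ηP) hL⟩

/-- … and the rough-class (F1-law) is implied by the whole-family (D) binders too, so the split record implies nothing new when (D) holds everywhere (sanity:
`coreOff_record_g56m` ⟸ split record's proof pattern). [formal bookkeeping] -/
theorem classQ_envelope_of_D (ηP : ℝ) {Ψ : (M₁ : ℕ) → (Fin M₁ → E3) → Fin M₁ → ℝ → ℝ} {μ : (M₁ : ℕ) → (Fin M₁ → E3) → Fin M₁ → ℝ} (hB : BasinD) (hM : MembershipD μ)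
    (hL : SlavedDMinus Ψ) : FamilyEnvelopeLaw (ClassQ ηP) tau0 T0 (withColumns Ψ μ) :=
  fun M z c M₀ z₀ c₀ e t hz hcl hm ht htT hch => envelopeD_of_taylorMinus hB hM hL M z c M₀ z₀ c₀ e t hz hcl hm ht htT (hch.mono_family (classQ_le_D ηP))

/-! ## §4. The FIXED-RADIUS retype of route (D) (critic row 1042: the GRADED basin (BASᴰ) `‖dev‖ ≤ κA₁·T₀(z₀)` is refuted in census — admissible
witnesses at `4.13 / 4.22 / 3.42·T₀` — while the FIXED radius `δ₀ = 1/20` is LP-certified; (MEMᴰ) is then asked at radius `δ₀` (cleared `μ ≡ 0` only at FZ00,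
`μ_adv × 4/3` elsewhere); `M_D(T2⁻)` unchanged).  The seam below needs NO law cap for the radius. -/

/-- ★ **(BAS-fix) `BasinFix 𝓘 τ δ T`** [ANALYTIC · INSTRUMENTABLE] — an admissible clean mono-phase cluster charted (coarse `τ`, raw roughness `0 ≤ t ≤ T(z₀)`)
by an instance of `𝓘` is `δ`-finely charted: `‖dev_a‖ ≤ δ` on the `63/10`-ball (FIXED radius; the tree's (BASᴿ) radius, read at the law). -/
def BasinFix (𝓘 : (M₀ : ℕ) → (Fin M₀ → E3) → Fin M₀ → Prop) (τ δ : ℝ) (T : (M₀ : ℕ) → (Fin M₀ → E3) → Fin M₀ → ℝ) : Prop :=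
  ∀ (M : ℕ) (z : Fin M → E3) (c : Fin M) (M₀ : ℕ) (z₀ : Fin M₀ → E3) (c₀ : Fin M₀) (e : Fin M → Fin M₀) (t : ℝ),
    Admissible M z c → CleanBall (63 / 10) z c → MonoPhaseBall (63 / 10) z c → 0 ≤ t → t ≤ T M₀ z₀ c₀ → ChartBy 𝓘 τ t z c z₀ c₀ e →
      FineChart δ z c z₀ c₀ e

/-- ★ **(MEM-fix) `MembershipFix 𝓘 τ δ T μ`** [COMBINATORIAL + TABLE · INSTRUMENTABLE] — the MG (MEM-law) with the FIXED fine radius `δ`: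
`frozenAvg − μ(z₁) ≤ S(z)` for every `δ`-finely charted admissible clean cluster. -/
def MembershipFix (𝓘 : (M₀ : ℕ) → (Fin M₀ → E3) → Fin M₀ → Prop) (τ δ : ℝ) (T : (M₀ : ℕ) → (Fin M₀ → E3) → Fin M₀ → ℝ)
    (μ : (M₁ : ℕ) → (Fin M₁ → E3) → Fin M₁ → ℝ) : Prop :=
  ∀ (M : ℕ) (z : Fin M → E3) (c : Fin M) (M₁ : ℕ) (z₁ : Fin M₁ → E3) (c₁ : Fin M₁) (e : Fin M → Fin M₁) (t : ℝ),
    Admissible M z c → CleanBall (63 / 10) z c → 0 ≤ t → t ≤ T M₁ z₁ c₁ → ChartBy 𝓘 τ t z c z₁ c₁ e → FineChart δ z c z₁ c₁ e →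
      frozenAvg z c z₁ c₁ e - μ M₁ z₁ c₁ ≤ ballAvg (9 / 5) z (xRec M z) c

/-- (BAS-law graded `κA·T`) ⟹ (BAS-fix `δ`) when `κA·tmax ≤ δ` under the law cap: the fixed basin is the WEAKER binder. [formal bookkeeping] -/
theorem basinFix_of_basinLaw {𝓘 : (M₀ : ℕ) → (Fin M₀ → E3) → Fin M₀ → Prop} {τ κA δ tmax : ℝ} {T : (M₀ : ℕ) → (Fin M₀ → E3) → Fin M₀ → ℝ} (hκ : 0 ≤ κA)
    (hδ : κA * tmax ≤ δ) (hT : LawLE 𝓘 T tmax) (h : BasinLaw 𝓘 τ κA T) : BasinFix 𝓘 τ δ T :=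
  fun M z c M₀ z₀ c₀ e t hz hcl hm ht htT hch a ha =>
    (h M z c M₀ z₀ c₀ e t hz hcl hm ht htT hch a ha).trans ((mul_le_mul_of_nonneg_left (hT M₀ z₀ c₀ hch.1) hκ).trans hδ)

/-- (MEM-fix `δ`) ⟹ (MEM-law graded `κA·T`) when `κA·tmax ≤ δ` under the law cap: the fixed membership is the STRONGER binder. [formal bookkeeping] -/
theorem membershipLaw_of_membershipFix {𝓘 : (M₀ : ℕ) → (Fin M₀ → E3) → Fin M₀ → Prop} {τ κA δ tmax : ℝ} {T : (M₀ : ℕ) → (Fin M₀ → E3) → Fin M₀ → ℝ}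
    {μ : (M₁ : ℕ) → (Fin M₁ → E3) → Fin M₁ → ℝ} (hκ : 0 ≤ κA) (hδ : κA * tmax ≤ δ) (hT : LawLE 𝓘 T tmax) (h : MembershipFix 𝓘 τ δ T μ) :
    MembershipLaw 𝓘 τ κA T μ :=
  fun M z c M₁ z₁ c₁ e t hz hcl ht htT hch hf =>
    h M z c M₁ z₁ c₁ e t hz hcl ht htT hch fun a ha => (hf a ha).trans ((mul_le_mul_of_nonneg_left (hT M₁ z₁ c₁ hch.1) hκ).trans hδ)

/-- (BAS-fix) is ANTITONE in the family. [formal bookkeeping] -/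
theorem basinFix_anti {𝓘 𝓘' : (M₀ : ℕ) → (Fin M₀ → E3) → Fin M₀ → Prop} (hle : FamilyLE 𝓘 𝓘') {τ δ : ℝ} {T : (M₀ : ℕ) → (Fin M₀ → E3) → Fin M₀ → ℝ}
    (h : BasinFix 𝓘' τ δ T) : BasinFix 𝓘 τ δ T :=
  fun M z c M₀ z₀ c₀ e t hz hcl hm ht htT hch => h M z c M₀ z₀ c₀ e t hz hcl hm ht htT (hch.mono_family hle)

/-- (MEM-fix) is ANTITONE in the family. [formal bookkeeping] -/
theorem membershipFix_anti {𝓘 𝓘' : (M₀ : ℕ) → (Fin M₀ → E3) → Fin M₀ → Prop} (hle : FamilyLE 𝓘 𝓘') {τ δ : ℝ} {T : (M₀ : ℕ) → (Fin M₀ → E3) → Fin M₀ → ℝ}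
    {μ : (M₁ : ℕ) → (Fin M₁ → E3) → Fin M₁ → ℝ} (h : MembershipFix 𝓘' τ δ T μ) : MembershipFix 𝓘 τ δ T μ :=
  fun M z c M₁ z₁ c₁ e t hz hcl ht htT hch hf => h M z c M₁ z₁ c₁ e t hz hcl ht htT (hch.mono_family hle) hf

/-- ★★ THE FIXED-RADIUS LEVEL-2 SEAM: (BAS-fix δ) ∧ (T2 at δ) ∧ (MEM-fix δ μ) ∧ (LIN-law δ Ψ) ⟹ (F1-law (Ψ + ϱ + μ)) — every family, law and tables; no law cap
needed. [folklore] -/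
theorem familyEnvelopeLaw_of_taylor_fix {𝓘 : (M₀ : ℕ) → (Fin M₀ → E3) → Fin M₀ → Prop} {τ δ : ℝ} {T : (M₀ : ℕ) → (Fin M₀ → E3) → Fin M₀ → ℝ}
    {G : (M₁ : ℕ) → (Fin M₁ → E3) → Fin M₁ → Fin M₁ → (E3 →L[ℝ] ℝ)} {w : (M₁ : ℕ) → (Fin M₁ → E3) → Fin M₁ → Fin M₁ → Fin M₁ → ℝ}
    {ϱ μ : (M₁ : ℕ) → (Fin M₁ → E3) → Fin M₁ → ℝ} {Ψ : (M₁ : ℕ) → (Fin M₁ → E3) → Fin M₁ → ℝ → ℝ} (hB : BasinFix 𝓘 τ δ T)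
    (hT2 : SmoothTaylorTwo 𝓘 τ δ G w ϱ) (hM : MembershipFix 𝓘 τ δ T μ) (hL : SlavedLaw 𝓘 τ δ T G w Ψ) :
    FamilyEnvelopeLaw 𝓘 τ T (fun M₀ z₀ c₀ t => Ψ M₀ z₀ c₀ t + ϱ M₀ z₀ c₀ + μ M₀ z₀ c₀) := by
  intro M z c M₀ z₀ c₀ e t hz hcl hm ht htT hch
  have hf := hB M z c M₀ z₀ c₀ e t hz hcl hm ht htT hch
  have h₁ := hT2 M z c M₀ z₀ c₀ e t hz hch hf
  have h₂ := hM M z c M₀ z₀ c₀ e t hz hcl ht htT hch hf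
  have h₃ := hL M z c M₀ z₀ c₀ e t hz hcl hm ht htT hch hf
  show _ - (Ψ M₀ z₀ c₀ (T M₀ z₀ c₀) + ϱ M₀ z₀ c₀ + μ M₀ z₀ c₀) ≤ _
  linarith

/-- ★ **(BASᴰ-fix)** `:= BasinFix 𝓘₀ (1/4) (1/20) T₀` — the basin of record after row 1042 (fixed radius `δ₀`). -/
def BasinDFix : Prop := BasinFix ChartFamilyD tau0 delta0 T0

/-- ★ **(MEMᴰ-fix μ)** `:= MembershipFix 𝓘₀ (1/4) (1/20) T₀ μ`. -/
def MembershipDFix (μ : (M₁ : ℕ) → (Fin M₁ → E3) → Fin M₁ → ℝ) : Prop := MembershipFix ChartFamilyD tau0 delta0 T0 μ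

/-- (BASᴰ) ⟹ (BASᴰ-fix). [formal bookkeeping] -/
theorem basinDFix_of_basinD (h : BasinD) : BasinDFix := basinFix_of_basinLaw kA1_nonneg kA1_mul_tmax0_le lawLE_chartFamilyD h

/-- (MEMᴰ-fix μ) ⟹ (MEMᴰ μ). [formal bookkeeping] -/
theorem membershipD_of_fix {μ : (M₁ : ℕ) → (Fin M₁ → E3) → Fin M₁ → ℝ} (h : MembershipDFix μ) : MembershipD μ :=
  membershipLaw_of_membershipFix kA1_nonneg kA1_mul_tmax0_le lawLE_chartFamilyD h

/-- ★★ (BASᴰ-fix) ∧ (MEMᴰ-fix μ) ∧ (LINᴰ⁻ Ψ) ⟹ (F1ᴰ (Ψ + ϱ₀ + μ)), (T2ᴰ⁻) discharged. [folklore] -/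
theorem envelopeD_of_taylorMinus_fix {Ψ : (M₁ : ℕ) → (Fin M₁ → E3) → Fin M₁ → ℝ → ℝ} {μ : (M₁ : ℕ) → (Fin M₁ → E3) → Fin M₁ → ℝ} (hB : BasinDFix)
    (hM : MembershipDFix μ) (hL : SlavedDMinus Ψ) : EnvelopeD (withColumns Ψ μ) :=
  familyEnvelopeLaw_of_taylor_fix hB taylorTwoDMinus_holds hM hL

/-- ★★★★ **THE FIXED-RADIUS RECORD `coreOff_record_g56f`** (route (D) RETYPED per critic row 1042) — [CORE-FAR] `CoreOffTubeFloor (63/10) (63/10) (24/5) (1/100) 0`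
from SIX binders: (BASᴰ-fix) · (MEMᴰ-fix μ) · (LINᴰ⁻ Ψ) · (F2-bent₀) · (F3ᴰ (Ψ + ϱ₀ + μ)) · [BRIDGE] · [SOFT-FAR]; (T2ᴰ⁻) is a theorem. [folklore] -/
theorem coreOff_record_g56f {Ψ : (M₁ : ℕ) → (Fin M₁ → E3) → Fin M₁ → ℝ → ℝ} {μ : (M₁ : ℕ) → (Fin M₁ → E3) → Fin M₁ → ℝ} (hB : BasinDFix) (hM : MembershipDFix μ)
    (hL : SlavedDMinus Ψ) (hR : FamilyRoomBent0) (hC : FamilyCertD (withColumns Ψ μ))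
    (hBand : BandFarFloor (63 / 10) (63 / 10) (24 / 5) (1 / 100) (3 / 50) (1 / 10) 0) (hS : SoftFarFloor (63 / 10) (63 / 10) (24 / 5) (1 / 100) (1 / 10) 0) :
    CoreOffTubeFloor (63 / 10) (63 / 10) (24 / 5) (1 / 100) 0 :=
  coreOff_of_edge_of_band_of_soft (edgeFar_D (envelopeD_of_taylorMinus_fix hB hM hL) hR hC) hBand hS

/-- The EDGE band of the fixed-radius record. [folklore] -/
theorem edgeFar_record_g56f {Ψ : (M₁ : ℕ) → (Fin M₁ → E3) → Fin M₁ → ℝ → ℝ} {μ : (M₁ : ℕ) → (Fin M₁ → E3) → Fin M₁ → ℝ} (hB : BasinDFix) (hM : MembershipDFix μ)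
    (hL : SlavedDMinus Ψ) (hR : FamilyRoomBent0) (hC : FamilyCertD (withColumns Ψ μ)) : EdgeFarFloor (63 / 10) (63 / 10) (24 / 5) (1 / 100) (3 / 50) 0 :=
  edgeFar_D (envelopeD_of_taylorMinus_fix hB hM hL) hR hC

/-- ★★★★ **THE DESIGNATE AFTER ROW 1042 `coreOff_record_g56_splitFix ηP`** — HOST-CLASS SPLIT with the PASSING CLASS `𝓘₀ᴾ(ηP)` closed by route (D) RETYPED
(fixed radius): (BASᴾ-fix) · (MEMᴾ-fix μ) · (LINᴾ⁻ Ψ) [(T2⁻) a theorem] · (F1-law on the rough class `𝓘₀ꟴ(ηP)`) [OPEN · IDEA-NEEDED: certifiable second-order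
force handle] · (F2-bent₀) · (F3ᴰ (Ψ + ϱ₀ + μ)) · [BRIDGE] · [SOFT-FAR].  Record threshold `ηP = 29/500`. [folklore] -/
theorem coreOff_record_g56_splitFix (ηP : ℝ) {Ψ : (M₁ : ℕ) → (Fin M₁ → E3) → Fin M₁ → ℝ → ℝ} {μ : (M₁ : ℕ) → (Fin M₁ → E3) → Fin M₁ → ℝ}
    (hBP : BasinFix (ClassP ηP) tau0 delta0 T0) (hMP : MembershipFix (ClassP ηP) tau0 delta0 T0 μ) (hLP : SlavedLaw (ClassP ηP) tau0 delta0 T0 G0 wMinus Ψ)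
    (hQ : FamilyEnvelopeLaw (ClassQ ηP) tau0 T0 (withColumns Ψ μ)) (hR : FamilyRoomBent0) (hC : FamilyCertD (withColumns Ψ μ))
    (hBand : BandFarFloor (63 / 10) (63 / 10) (24 / 5) (1 / 100) (3 / 50) (1 / 10) 0) (hS : SoftFarFloor (63 / 10) (63 / 10) (24 / 5) (1 / 100) (1 / 10) 0) :
    CoreOffTubeFloor (63 / 10) (63 / 10) (24 / 5) (1 / 100) 0 :=
  coreOff_of_edge_of_band_of_soft
    (edgeFar_D (familyEnvelopeLaw_of_split (familyEnvelopeLaw_of_taylor_fix hBP (taylorTwoMinus_classP ηP) hMP hLP) hQ) hR hC) hBand hS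

/-- The EDGE band of the designate. [folklore] -/
theorem edgeFar_record_g56_splitFix (ηP : ℝ) {Ψ : (M₁ : ℕ) → (Fin M₁ → E3) → Fin M₁ → ℝ → ℝ} {μ : (M₁ : ℕ) → (Fin M₁ → E3) → Fin M₁ → ℝ}
    (hBP : BasinFix (ClassP ηP) tau0 delta0 T0) (hMP : MembershipFix (ClassP ηP) tau0 delta0 T0 μ) (hLP : SlavedLaw (ClassP ηP) tau0 delta0 T0 G0 wMinus Ψ)
    (hQ : FamilyEnvelopeLaw (ClassQ ηP) tau0 T0 (withColumns Ψ μ)) (hR : FamilyRoomBent0) (hC : FamilyCertD (withColumns Ψ μ)) :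
    EdgeFarFloor (63 / 10) (63 / 10) (24 / 5) (1 / 100) (3 / 50) 0 :=
  edgeFar_D (familyEnvelopeLaw_of_split (familyEnvelopeLaw_of_taylor_fix hBP (taylorTwoMinus_classP ηP) hMP hLP) hQ) hR hC

/-- The passing-class fixed binders follow from the whole-family fixed binders (antitonicity). [formal bookkeeping] -/
theorem classP_fixBinders_of_D (ηP : ℝ) {Ψ : (M₁ : ℕ) → (Fin M₁ → E3) → Fin M₁ → ℝ → ℝ} {μ : (M₁ : ℕ) → (Fin M₁ → E3) → Fin M₁ → ℝ} (hB : BasinDFix)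
    (hM : MembershipDFix μ) (hL : SlavedDMinus Ψ) :
    BasinFix (ClassP ηP) tau0 delta0 T0 ∧ MembershipFix (ClassP ηP) tau0 delta0 T0 μ ∧ SlavedLaw (ClassP ηP) tau0 delta0 T0 G0 wMinus Ψ :=
  ⟨basinFix_anti (classP_le_D ηP) hB, membershipFix_anti (classP_le_D ηP) hM, slavedLaw_anti (classP_le_D ηP) hL⟩

end Summit.AtomisticToContinuum.Crystallization.Theorems.FrustratedLawDichotomyStrainedPatchTaylorKbandMinusD
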